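import Mathlib
import Literature.NumberTheory.LFunctions.Zhang2022.Section15U009TailBounds
import Literature.NumberTheory.LFunctions.Zhang2022.Section7Eq73Edge
import HarnessLib

/-!
# Zhang (2022) §15 u009 (p. 80, tex L4037), first half: the tail `Σ_{m>P²}` — moving the segment
# `𝔍(−1)` to `𝔍(−𝓛⁹)`

Topic `Literature/NumberTheory/LFunctions/Zhang2022` (Landau–Siegel audit tree; verdict-neutral).
Y. Zhang, *Discrete mean estimates and the Landau–Siegel zero*, arXiv:2211.02515v1 (2022)
[Zhang2022LandauSiegel] — **an unrefereed manuscript under adjudication; nothing here asserts or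
denies its Theorems 1–2.** ZHANG-L discharge lane (helper under leaf `Typed.Section15A.Eq15_6`, node
`Z22:§15.u009`, via the tree edge `eq15_4_of`); THEOREM-ONLY.

§15 p. 80 (tex L4037): "In a way similar to the proof of (7.3), the sum over `ψ ∈ Ψ₁` can be extended
to the sum over `ψ ∈ Ψ`". The §15 mirror image of the tree's `Typed.Sec14.Eq143.tail` ((14.3)/(7.3):
"moving the segment to `𝔍(𝓛⁹)`", §7 p. 35): for every `ψ ∈ Ψ`, the `𝔍(−1)`-integral of the TAIL part
`ψ̄(D)D^{−(1−s)}·(Σ_{m>⌊P²⌋} k̃(m)ψ̄(m)m^{−(1−s)})·B(s,ψ)·ω(s)` of the u008 integrand (holomorphic on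
`Re s < 0`) is `O(e^{−𝓛¹⁰/16})`: Cauchy's theorem on the rectangle with vertical sides `𝔍(−𝓛⁹)`,
`𝔍(−1)` (`Section7aStatements.norm_intJ_sub_intJ_le`); on `1/2 − 𝓛⁹ ≤ σ ≤ −1/2`,
`|D^{−(1−s)}|·|tail|·|B| ≤ S₄C_b⌈PT⁻²⌉(⌊P²⌋+1)²·b^{1−σ}`, `b = ⌈PT⁻²⌉/(D(⌊P²⌋+1)) ≤ T⁻¹`
(`norm_Dpow_tail_Bpoly_le`, `base_le_inv_bigT'`), so the far segment carries `b^{𝓛⁹+1/2} ≤ e^{−𝓛¹⁰}`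
against (7.4) (`eq74_holds`), and the horizontal sides carry `|ω| ≤ 2e^{1/4}e^{−𝓛¹⁰/4}`
(`norm_omegaW_side_le_left`, the reflection of `Section7aStatements.norm_omegaW_side_le`).

## References

* Y. Zhang, arXiv:2211.02515v1 (2022), §15 p. 80, tex L4037; §7 p. 35, tex L1886–L1893; §2 (2.15).
  [cite: Zhang2022LandauSiegel, §15 p. 80]
-/

noncomputable section

open Complex Real MeasureTheory Set intervalIntegral
open scoped ComplexConjugate

namespace Literature.NumberTheory.LFunctions.Zhang2022.Typed.Section15A.U009

open Skeleton Section7aStatements Section7Eq73Edge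

variable (c' : ℝ) {D : ℕ}

/-! ### Real bookkeeping -/

/-- `D^{−u}·Y^{3/2−u}·N^{u−1} ≤ Y²N⁻¹·(N/(DY))^u` for `D, N > 0`, `Y ≥ 1`, `u ≥ 3/2`. [folklore] -/
private theorem rpow_bookkeeping {Dr Y Nr : ℝ} (hD : 0 < Dr) (hY : 1 ≤ Y) (hN : 0 < Nr) (u : ℝ) :
    Dr ^ (-u) * Y ^ (3 / 2 - u) * Nr ^ (u - 1) ≤ Y ^ 2 * Nr⁻¹ * (Nr / (Dr * Y)) ^ u := by
  have hY0 : 0 < Y := by linarith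
  have h1 : Y ^ (3 / 2 - u) ≤ Y ^ (2 - u) := Real.rpow_le_rpow_of_exponent_le hY (by linarith)
  have hA : 0 < Dr ^ u := Real.rpow_pos_of_pos hD u
  have hB : 0 < Y ^ u := Real.rpow_pos_of_pos hY0 u
  have e1 : Dr ^ (-u) = (Dr ^ u)⁻¹ := Real.rpow_neg hD.le u
  have e2 : Y ^ (2 - u) = Y ^ 2 / Y ^ u := by
    rw [Real.rpow_sub hY0, Real.rpow_two]
  have e3 : Nr ^ (u - 1) = Nr ^ u / Nr := Real.rpow_sub_one hN.ne' u
  have e4 : (Nr / (Dr * Y)) ^ u = Nr ^ u / (Dr ^ u * Y ^ u) := by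
    rw [Real.div_rpow hN.le (mul_nonneg hD.le hY0.le), Real.mul_rpow hD.le hY0.le]
  have h0 : 0 ≤ Dr ^ (-u) := Real.rpow_nonneg hD.le _
  have h0' : 0 ≤ Nr ^ (u - 1) := Real.rpow_nonneg hN.le _
  calc Dr ^ (-u) * Y ^ (3 / 2 - u) * Nr ^ (u - 1) ≤ Dr ^ (-u) * Y ^ (2 - u) * Nr ^ (u - 1) :=
        mul_le_mul_of_nonneg_right (mul_le_mul_of_nonneg_left h1 h0) h0'
    _ = Y ^ 2 * Nr⁻¹ * (Nr / (Dr * Y)) ^ u := by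
        rw [e1, e2, e3, e4]
        field_simp

/-- `b^{𝓛⁹+1/2} ≤ e^{−𝓛¹⁰}` for `0 ≤ b ≤ T⁻¹ = e^{−𝓛^{1.1}}`, `𝓛 ≥ 1`. [folklore] -/
private theorem base_pow_le {D : ℕ} (hℓ : 1 ≤ ell D) {b : ℝ} (hb0 : 0 ≤ b) (hbT : b ≤ (bigT D)⁻¹) :
    b ^ (ell D ^ 9 + 1 / 2) ≤ Real.exp (-ell D ^ 10) := by
  have hσ1 : 0 ≤ ell D ^ 9 + 1 / 2 := by positivity
  have h9 : 0 ≤ ell D ^ 9 := by positivity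
  calc b ^ (ell D ^ 9 + 1 / 2) ≤ ((bigT D)⁻¹) ^ (ell D ^ 9 + 1 / 2) := Real.rpow_le_rpow hb0 hbT hσ1
    _ = Real.exp (-(ell D ^ (1.1 : ℝ)) * (ell D ^ 9 + 1 / 2)) := by
        rw [bigT, ← Real.exp_neg, Real.exp_mul]
    _ ≤ Real.exp (-ell D ^ 10) := by
        apply Real.exp_le_exp.mpr
        have h11 : ell D ≤ ell D ^ (1.1 : ℝ) := by
          calc ell D = ell D ^ (1 : ℝ) := (Real.rpow_one _).symm
            _ ≤ ell D ^ (1.1 : ℝ) := Real.rpow_le_rpow_of_exponent_le hℓ (by norm_num)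
        have h10 : ell D ^ 10 = ell D * ell D ^ 9 := by ring
        have hm : ell D * ell D ^ 9 ≤ ell D ^ (1.1 : ℝ) * (ell D ^ 9 + 1 / 2) :=
          mul_le_mul h11 (by linarith) h9 (le_trans (by linarith) h11)
        rw [h10]; linarith

/-- `P(P²+1)² ≤ e^{2+5𝓛⁹}` (`P = e^{𝓛⁹}`). [folklore] -/
private theorem bigP_mul_sq_le {D : ℕ} (hℓ : 1 ≤ ell D) :
    bigP D * (bigP D ^ 2 + 1) ^ 2 ≤ Real.exp (2 + 5 * ell D ^ 9) := by
  have h9 : 0 ≤ ell D ^ 9 := pow_nonneg (le_trans zero_le_one hℓ) 9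
  have hP2 : bigP D ^ 2 + 1 ≤ Real.exp (1 + 2 * ell D ^ 9) := by
    have h1 : bigP D ^ 2 = Real.exp (2 * ell D ^ 9) := by rw [bigP, ← Real.exp_nat_mul]; norm_num
    rw [h1, Real.exp_add]
    have h2 : (1 : ℝ) ≤ Real.exp (2 * ell D ^ 9) := Real.one_le_exp (by linarith)
    nlinarith [Real.add_one_le_exp (1 : ℝ), Real.exp_pos (2 * ell D ^ 9)]
  have hsq : (bigP D ^ 2 + 1) ^ 2 ≤ Real.exp (2 + 4 * ell D ^ 9) := by
    calc (bigP D ^ 2 + 1) ^ 2 ≤ Real.exp (1 + 2 * ell D ^ 9) ^ 2 := pow_le_pow_left₀ (by positivity) hP2 2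
      _ = Real.exp (2 + 4 * ell D ^ 9) := by rw [← Real.exp_nat_mul]; ring_nf
  calc bigP D * (bigP D ^ 2 + 1) ^ 2 ≤ Real.exp (ell D ^ 9) * Real.exp (2 + 4 * ell D ^ 9) :=
        mul_le_mul (le_of_eq rfl) hsq (by positivity) (Real.exp_pos _).le
    _ = Real.exp (2 + 5 * ell D ^ 9) := by rw [← Real.exp_add]; ring_nf

/-- Budget of the far segment: `P(P²+1)²e^{−𝓛¹⁰} ≤ e^{−𝓛¹⁰/16}` for `𝓛 ≥ 40`. [folklore] -/
private theorem budget_far {D : ℕ} (hℓ : 40 ≤ ell D) :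
    bigP D * (bigP D ^ 2 + 1) ^ 2 * Real.exp (-ell D ^ 10) ≤ Real.exp (-(1 / 16) * ell D ^ 10) := by
  have hℓ1 : 1 ≤ ell D := le_trans (by norm_num) hℓ
  have h10 : ell D ^ 10 = ell D * ell D ^ 9 := by ring
  have h9 : 1 ≤ ell D ^ 9 := one_le_pow₀ hℓ1
  have hm : 40 * ell D ^ 9 ≤ ell D * ell D ^ 9 := mul_le_mul_of_nonneg_right hℓ (by linarith)
  calc bigP D * (bigP D ^ 2 + 1) ^ 2 * Real.exp (-ell D ^ 10)
      ≤ Real.exp (2 + 5 * ell D ^ 9) * Real.exp (-ell D ^ 10) :=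
        mul_le_mul_of_nonneg_right (bigP_mul_sq_le hℓ1) (Real.exp_pos _).le
    _ = Real.exp (2 + 5 * ell D ^ 9 - ell D ^ 10) := by rw [← Real.exp_add]; ring_nf
    _ ≤ Real.exp (-(1 / 16) * ell D ^ 10) := Real.exp_le_exp.mpr (by rw [h10]; linarith)

/-- Budget of the horizontal sides: `(𝓛⁹−1)·P(P²+1)²·e^{−𝓛¹⁰/4} ≤ e^{−𝓛¹⁰/16}` for `𝓛 ≥ 40`. [folklore] -/
private theorem budget_sides {D : ℕ} (hℓ : 40 ≤ ell D) :
    (ell D ^ 9 - 1) * (bigP D * (bigP D ^ 2 + 1) ^ 2 * Real.exp (-(ell D ^ 10 / 4))) ≤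
      Real.exp (-(1 / 16) * ell D ^ 10) := by
  have hℓ1 : 1 ≤ ell D := le_trans (by norm_num) hℓ
  have h10 : ell D ^ 10 = ell D * ell D ^ 9 := by ring
  have h9 : 1 ≤ ell D ^ 9 := one_le_pow₀ hℓ1
  have hm : 40 * ell D ^ 9 ≤ ell D * ell D ^ 9 := mul_le_mul_of_nonneg_right hℓ (by linarith)
  have h9' : 2 ≤ ell D ^ 9 := le_trans (by linarith) (le_self_pow₀ hℓ1 (by norm_num))
  have hℓ9exp : ell D ^ 9 - 1 ≤ Real.exp (ell D ^ 9) := by linarith [Real.add_one_le_exp (ell D ^ 9)]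
  have hQ0 : 0 ≤ bigP D * (bigP D ^ 2 + 1) ^ 2 * Real.exp (-(ell D ^ 10 / 4)) :=
    mul_nonneg (mul_nonneg (Real.exp_pos _).le (sq_nonneg _)) (Real.exp_pos _).le
  calc (ell D ^ 9 - 1) * (bigP D * (bigP D ^ 2 + 1) ^ 2 * Real.exp (-(ell D ^ 10 / 4)))
      ≤ Real.exp (ell D ^ 9) * (Real.exp (2 + 5 * ell D ^ 9) * Real.exp (-(ell D ^ 10 / 4))) :=
        mul_le_mul hℓ9exp (mul_le_mul_of_nonneg_right (bigP_mul_sq_le hℓ1) (Real.exp_pos _).le)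
          hQ0 (Real.exp_pos _).le
    _ = Real.exp (2 + 6 * ell D ^ 9 - ell D ^ 10 / 4) := by
        rw [← Real.exp_add, ← Real.exp_add]; ring_nf
    _ ≤ Real.exp (-(1 / 16) * ell D ^ 10) := Real.exp_le_exp.mpr (by rw [h10]; linarith)

/-! ### The base `b = ⌈PT⁻²⌉/(D(⌊P²⌋+1)) ≤ T⁻¹` and the pointwise bound -/

/-- **`b = ⌈PT⁻²⌉/(D(⌊P²⌋+1)) ≤ T⁻¹`** (`⌈PT⁻²⌉ ≤ PT⁻² + 1`, `⌊P²⌋ + 1 ≥ P²`, `D ≥ 1`, `T ≤ P`, `P ≥ 2`):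
the base of the `(1−σ)`-power in `|D^{−(1−s)}|·|tail|·|B|`. [cite: Zhang2022LandauSiegel, §7 p. 34–35, tex L1878–L1890] -/
theorem base_le_inv_bigT' {D : ℕ} (hD1 : 1 ≤ D) (hℓ : 1 ≤ ell D) :
    (⌈bigP D / bigT D ^ 2⌉₊ : ℝ) / ((D : ℝ) * ((⌊bigP D ^ 2⌋₊ : ℝ) + 1)) ≤ (bigT D)⁻¹ := by
  have hP0 : 0 < bigP D := Real.exp_pos _
  have hT1 : 1 ≤ bigT D := by rw [bigT]; exact Real.one_le_exp (by positivity)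
  have hT0 : 0 < bigT D := by linarith
  have hD' : (1 : ℝ) ≤ D := by exact_mod_cast hD1
  have hYP : bigP D ^ 2 ≤ (⌊bigP D ^ 2⌋₊ : ℝ) + 1 := (Nat.lt_floor_add_one _).le
  have hY0 : 0 < (⌊bigP D ^ 2⌋₊ : ℝ) + 1 := by positivity
  -- `T ≤ P` and `P ≥ 2`
  have hTP : bigT D ≤ bigP D := by
    rw [bigT, bigP]
    apply Real.exp_le_exp.mpr
    calc ell D ^ (1.1 : ℝ) ≤ ell D ^ ((9 : ℕ) : ℝ) := Real.rpow_le_rpow_of_exponent_le hℓ (by norm_num)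
      _ = ell D ^ 9 := Real.rpow_natCast _ _
  have hP2 : 2 ≤ bigP D := by
    rw [bigP]; have := Real.add_one_le_exp (ell D ^ 9); nlinarith [one_le_pow₀ (n := 9) hℓ]
  -- `⌈P/T²⌉ ≤ P/T² + 1`
  have hN : (⌈bigP D / bigT D ^ 2⌉₊ : ℝ) ≤ bigP D / bigT D ^ 2 + 1 :=
    (Nat.ceil_lt_add_one (by positivity)).le
  -- reduce to `(P/T² + 1)·T ≤ P²`
  have hden : bigP D ^ 2 ≤ (D : ℝ) * ((⌊bigP D ^ 2⌋₊ : ℝ) + 1) := by nlinarith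
  calc (⌈bigP D / bigT D ^ 2⌉₊ : ℝ) / ((D : ℝ) * ((⌊bigP D ^ 2⌋₊ : ℝ) + 1))
      ≤ (bigP D / bigT D ^ 2 + 1) / bigP D ^ 2 :=
        div_le_div₀ (by positivity) hN (by positivity) hden
    _ ≤ (bigT D)⁻¹ := by
        rw [div_le_iff₀ (by positivity)]
        -- `P/T² + 1 ≤ T⁻¹·P²`
        have hq : 1 ≤ bigP D / bigT D := by rw [le_div_iff₀ hT0, one_mul]; exact hTP
        have h1 : bigP D / bigT D ^ 2 ≤ bigP D / bigT D := by
          apply div_le_div_of_nonneg_left hP0.le hT0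
          nlinarith
        have h2 : (bigT D)⁻¹ * bigP D ^ 2 = bigP D / bigT D * bigP D := by
          field_simp
        rw [h2]
        nlinarith [mul_nonneg (sub_nonneg.2 hq) (sub_nonneg.2 hP2)]

/-- **The pointwise bound on `Re s ≤ −1/2`** (the mirror of "`Z⁻¹ ≪ (pt₀)^{σ−1/2}`, tail `≪ P^{2(1−σ)}`,
`A ≪ (PT⁻²)^σ`" of §7 p. 34): with `u = Re(1−s) ≥ 3/2`,
`|ψ̄(D)D^{−(1−s)}|·|Σ_{m>⌊P²⌋}k̃ψ̄(m)m^{−(1−s)}|·|B(s,ψ)| ≤ S₄C_b⌈PT⁻²⌉(⌊P²⌋+1)²·b^{u}`, `b` as in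
`base_le_inv_bigT'` (`norm_LSeries_ktilde_tail_le`, `norm_Bpoly_le_of_re_nonpos`, `rpow_bookkeeping`), `𝓛 ≥ 3`.
[cite: Zhang2022LandauSiegel, §7 p. 34, tex L1878–L1882; §15 p. 80, tex L4037] -/
theorem norm_Dpow_tail_Bpoly_le [NeZero D] (χ : DirichletCharacter ℂ D) (hℓ3 : 3 ≤ ell D) (x : Chr D)
    {s : ℂ} (hs : s.re ≤ -1 / 2) :
    ‖conj (x.ψ (D : ZMod x.p)) * (D : ℂ) ^ (-(1 - s)) *
        LSeries (fun m : ℕ => if ⌊bigP D ^ 2⌋₊ < m then ktilde c' D m * conj (x.ψ (m : ZMod x.p)) else 0)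
          (1 - s) * Bpoly χ x s‖ ≤
      (∑' m : ℕ, MeanSquareMajorant.tau 4 m * (m : ℝ) ^ (-(3 / 2 : ℝ))) *
        ((1 + ‖iota2‖) * (‖iota3‖ + ‖iota4‖)) * (⌈bigP D / bigT D ^ 2⌉₊ : ℝ) *
        ((⌊bigP D ^ 2⌋₊ : ℝ) + 1) ^ 2 *
        ((⌈bigP D / bigT D ^ 2⌉₊ : ℝ) / ((D : ℝ) * ((⌊bigP D ^ 2⌋₊ : ℝ) + 1))) ^ (1 - s).re := by
  have hℓ0 : 0 < ell D := by linarith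
  have hD0 : 0 < D := Nat.pos_of_ne_zero (NeZero.ne D)
  have hDr : (0 : ℝ) < D := by exact_mod_cast hD0
  set S : ℝ := ∑' m : ℕ, MeanSquareMajorant.tau 4 m * (m : ℝ) ^ (-(3 / 2 : ℝ)) with hS
  set Cb : ℝ := (1 + ‖iota2‖) * (‖iota3‖ + ‖iota4‖) with hCb
  set Nr : ℝ := (⌈bigP D / bigT D ^ 2⌉₊ : ℝ) with hNr
  set Y : ℝ := (⌊bigP D ^ 2⌋₊ : ℝ) + 1 with hY
  set u : ℝ := (1 - s).re with hu
  have hS0 : 0 ≤ S := tsum_nonneg fun m => mul_nonneg (MeanSquareMajorant.tau_nonneg 4 m)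
    (Real.rpow_nonneg (Nat.cast_nonneg m) _)
  have hCb0 : 0 ≤ Cb := by positivity
  have hu32 : 3 / 2 ≤ u := by rw [hu]; simp only [sub_re, one_re]; linarith
  have hure : -s.re = u - 1 := by rw [hu]; simp only [sub_re, one_re]; ring
  have hY1 : 1 ≤ Y := by rw [hY]; linarith [(Nat.cast_nonneg ⌊bigP D ^ 2⌋₊ : (0 : ℝ) ≤ _)]
  have hNr0 : 0 < Nr := by
    rw [hNr]
    have : 0 < ⌈bigP D / bigT D ^ 2⌉₊ := Nat.ceil_pos.mpr (by
      have hP0 : 0 < bigP D := Real.exp_pos _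
      have hT0 : 0 < bigT D := Real.exp_pos _
      positivity)
    exact_mod_cast this
  -- the four factors
  have hψ : ‖conj (x.ψ (D : ZMod x.p))‖ ≤ 1 := by
    rw [Complex.norm_conj]; exact DirichletCharacter.norm_le_one _ _
  have hDpow : ‖(D : ℂ) ^ (-(1 - s))‖ = (D : ℝ) ^ (-u) := by
    rw [Complex.norm_natCast_cpow_of_pos hD0, Complex.neg_re]
  have hL := norm_LSeries_ktilde_tail_le c' x hℓ0 ⌊bigP D ^ 2⌋₊ (w := 1 - s) hu32
  have hB := norm_Bpoly_le_of_re_nonpos χ x hℓ3 (s := s) (by linarith)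
  rw [hure] at hB
  have hbk := rpow_bookkeeping hDr hY1 hNr0 u
  have hL0 : 0 ≤ S * Y ^ (3 / 2 - u) := mul_nonneg hS0 (Real.rpow_nonneg (by linarith) _)
  have hD0' : 0 ≤ (D : ℝ) ^ (-u) := Real.rpow_nonneg hDr.le _
  rw [norm_mul, norm_mul, norm_mul, hDpow]
  calc ‖conj (x.ψ (D : ZMod x.p))‖ * (D : ℝ) ^ (-u) * ‖LSeries (fun m : ℕ =>
          if ⌊bigP D ^ 2⌋₊ < m then ktilde c' D m * conj (x.ψ (m : ZMod x.p)) else 0) (1 - s)‖ *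
        ‖Bpoly χ x s‖
      ≤ 1 * (D : ℝ) ^ (-u) * (S * Y ^ (3 / 2 - u)) * (Cb * Nr ^ 2 * Nr ^ (u - 1)) :=
        mul_le_mul (mul_le_mul (mul_le_mul_of_nonneg_right hψ hD0') hL (norm_nonneg _)
          (mul_nonneg zero_le_one hD0')) hB (norm_nonneg _)
          (mul_nonneg (mul_nonneg zero_le_one hD0') hL0)
    _ = S * Cb * Nr ^ 2 * ((D : ℝ) ^ (-u) * Y ^ (3 / 2 - u) * Nr ^ (u - 1)) := by ring
    _ ≤ S * Cb * Nr ^ 2 * (Y ^ 2 * Nr⁻¹ * (Nr / ((D : ℝ) * Y)) ^ u) :=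
        mul_le_mul_of_nonneg_left hbk (by positivity)
    _ = S * Cb * Nr * Y ^ 2 * (Nr / ((D : ℝ) * Y)) ^ u := by
        have hNr' : Nr ≠ 0 := hNr0.ne'
        field_simp

/-! ### The weight on the left horizontal sides -/

/-- `|ω(u+it)| = |ω((1−u)+it)|` (the modulus of `ω` depends on `σ` through `(σ−1/2)²`).
[cite: Zhang2022LandauSiegel, §2 (2.15)] -/
theorem norm_omegaW_reflect {D : ℕ} (hℓ : 0 < ell D) (u t : ℝ) :
    ‖omegaW D ((u : ℂ) + (t : ℂ) * I)‖ = ‖omegaW D (((1 - u : ℝ) : ℂ) + (t : ℂ) * I)‖ := by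
  have hL2 : 0 < ell2 D := by rw [ell2]; positivity
  rw [omegaW, omegaW, SmoothWeight.norm_omega_eq hL2, SmoothWeight.norm_omega_eq hL2]
  simp only [Complex.add_re, Complex.ofReal_re, Complex.mul_re, Complex.I_re, Complex.I_im,
    Complex.ofReal_im, mul_zero, mul_one, sub_zero, Complex.add_im, Complex.mul_im, zero_add, add_zero]
  congr 2
  ring

/-- On the horizontal sides `t = 2πt₀ ± 𝓛₁`, `1/2 − 𝓛⁹ ≤ σ ≤ 1/2` (the LEFT half-strip), the weight is
exponentially small: `|ω(σ+it)| ≤ 2e^{1/4}e^{−𝓛¹⁰/4}` (reflection of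
`Section7aStatements.norm_omegaW_side_le`). [cite: Zhang2022LandauSiegel, §7 (7.4) p.34; §2 (2.15)] -/
theorem norm_omegaW_side_le_left {D : ℕ} (hD : 3 ≤ D) {u v : ℝ} (hu0 : 1 / 2 - ell D ^ 9 ≤ u)
    (hu1 : u ≤ 1 / 2) (hv : v ^ 2 = ell1 D ^ 2) :
    ‖omegaW D ((u : ℂ) + ((2 * π * t0 D + v : ℝ) : ℂ) * I)‖ ≤
      2 * Real.exp (1 / 4) * Real.exp (-(ell D ^ 10 / 4)) := by
  have hℓ : 0 < ell D := by
    rw [ell]; exact Real.log_pos (by exact_mod_cast (show 1 < D by omega))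
  rw [norm_omegaW_reflect hℓ]
  exact norm_omegaW_side_le hD (by linarith) (by linarith) hv

/-! ### The contour shift -/

/-- `2πt₀ − 𝓛₁ > 0` for `𝓛 ≥ 1`. [folklore] -/
private theorem twoPiT0_sub_ell1_pos {D : ℕ} (hℓ : 1 ≤ ell D) : 0 < 2 * π * t0 D - ell1 D := by
  have h1 : ell D ^ 405 ≤ ell D ^ 519 := pow_le_pow_right₀ hℓ (by norm_num)
  have h2 : 1 ≤ ell D ^ 519 := one_le_pow₀ hℓ
  rw [t0, ell1]; nlinarith [Real.pi_gt_three]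

/-- **The §15.u009 mirror of `Z22:§7.u017`** ("moving the segment to `𝔍(𝓛⁹)`", here to `𝔍(−𝓛⁹)`):
eventually in `D`, for every `ψ ∈ Ψ`,
`‖∫_{𝔍(−1)} ψ̄(D)D^{−(1−s)}·(Σ_{m>⌊P²⌋}k̃(m)ψ̄(m)m^{−(1−s)})·B(s,ψ)·ω(s) ds‖ ≤ C·e^{−𝓛¹⁰/16}`
with `C = S₄C_b(max(C₇₄,0) + 4e^{1/4})` (`S₄ = Σ τ₄(m)m^{−3/2}`, `C₇₄` the constant of (7.4)).
[cite: Zhang2022LandauSiegel, §15 p. 80, tex L4037; §7 p. 35, tex L1890] -/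
theorem tail (c' : ℝ) : ∃ C : ℝ, ForAllLarge fun D _ χ => ∀ x : Chr D,
    ‖intJ D (-1) (fun s => conj (x.ψ (D : ZMod x.p)) * (D : ℂ) ^ (-(1 - s)) *
        LSeries (fun m : ℕ => if ⌊bigP D ^ 2⌋₊ < m then ktilde c' D m * conj (x.ψ (m : ZMod x.p)) else 0)
          (1 - s) * Bpoly χ x s * omegaW D s)‖ ≤
      C * Real.exp (-(1 / 16) * ell D ^ 10) := by
  obtain ⟨C₇₄, D₁, H74⟩ := eq74_holds
  obtain ⟨D₄, hD₄⟩ := exists_nat_forall_le_ell 40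
  set S : ℝ := ∑' m : ℕ, MeanSquareMajorant.tau 4 m * (m : ℝ) ^ (-(3 / 2 : ℝ)) with hSdef
  set Cb : ℝ := (1 + ‖iota2‖) * (‖iota3‖ + ‖iota4‖) with hCbdef
  have hS0 : 0 ≤ S := tsum_nonneg fun m => mul_nonneg (MeanSquareMajorant.tau_nonneg 4 m)
    (Real.rpow_nonneg (Nat.cast_nonneg m) _)
  have hCb0 : 0 ≤ Cb := by positivity
  set C' : ℝ := max C₇₄ 0 with hC'
  refine ⟨S * Cb * (C' + 4 * Real.exp (1 / 4)), max (max D₁ D₄) 3, fun D _ χ hD hq hp x => ?_⟩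
  have hD1 : D₁ ≤ D := le_trans (le_trans (le_max_left _ _) (le_max_left _ _)) hD
  have hℓ40 : (40 : ℝ) ≤ ell D := hD₄ D (le_trans (le_trans (le_max_right _ _) (le_max_left _ _)) hD)
  have hD3 : 3 ≤ D := le_trans (le_max_right _ _) hD
  have hD1' : 1 ≤ D := le_trans (by norm_num) hD3
  have hD0 : 0 < D := by omega
  have hℓ1 : 1 ≤ ell D := le_trans (by norm_num) hℓ40
  have hℓ3 : 3 ≤ ell D := le_trans (by norm_num) hℓ40
  have hℓ0 : 0 < ell D := by linarith
  have hℓ9 : 1 ≤ ell D ^ 9 := one_le_pow₀ hℓ1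
  have hL0 : 0 ≤ ell1 D := by rw [ell1]; exact pow_nonneg (le_trans zero_le_one hℓ1) _
  have hside : 0 < 2 * π * t0 D - ell1 D := twoPiT0_sub_ell1_pos hℓ1
  have hT1 : 1 ≤ bigT D := by rw [bigT]; exact Real.one_le_exp (by positivity)
  have hP0 : 0 < bigP D := Real.exp_pos _
  -- the base
  set b : ℝ := (⌈bigP D / bigT D ^ 2⌉₊ : ℝ) / ((D : ℝ) * ((⌊bigP D ^ 2⌋₊ : ℝ) + 1)) with hb
  have hbT : b ≤ (bigT D)⁻¹ := base_le_inv_bigT' hD1' hℓ1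
  have hb0 : 0 ≤ b := by
    rw [hb]
    exact div_nonneg (Nat.cast_nonneg _) (mul_nonneg (Nat.cast_nonneg _)
      (by linarith [(Nat.cast_nonneg ⌊bigP D ^ 2⌋₊ : (0 : ℝ) ≤ _)]))
  have hb1 : b ≤ 1 := hbT.trans (inv_le_one_of_one_le₀ hT1)
  -- the integrand and its holomorphy
  set Lf : ℂ → ℂ := fun w =>
    LSeries (fun m : ℕ => if ⌊bigP D ^ 2⌋₊ < m then ktilde c' D m * conj (x.ψ (m : ZMod x.p)) else 0) w
    with hLf
  set F : ℂ → ℂ := fun s => conj (x.ψ (D : ZMod x.p)) * (D : ℂ) ^ (-(1 - s)) * Lf (1 - s) *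
    Bpoly χ x s * omegaW D s with hF
  have hopen : IsOpen {w : ℂ | 1 < w.re} := isOpen_lt continuous_const Complex.continuous_re
  have hLdiff : DifferentiableOn ℂ Lf {w : ℂ | 1 < w.re} :=
    differentiableOn_LSeries_ktilde_tail c' x hℓ0 _
  have hFat : ∀ s : ℂ, s.re < 0 → DifferentiableAt ℂ F s := by
    intro s hre
    have hw : (1 - s) ∈ {w : ℂ | 1 < w.re} := by
      simp only [Set.mem_setOf_eq, sub_re, one_re]; linarith
    have h1 : DifferentiableAt ℂ (fun s : ℂ => (D : ℂ) ^ (-(1 - s))) s :=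
      DifferentiableAt.const_cpow (by fun_prop) (Or.inl (Nat.cast_ne_zero.mpr hD0.ne'))
    have h2 : DifferentiableAt ℂ (fun s : ℂ => Lf (1 - s)) s :=
      (hLdiff.differentiableAt (hopen.mem_nhds hw)).comp s ((differentiableAt_const _).sub differentiableAt_id)
    exact ((((differentiableAt_const _).mul h1).mul h2).mul
      ((Typed.Section17.differentiable_Bpoly χ x) s)).mul ((differentiable_omegaW D) s)
  have hdiff : DifferentiableOn ℂ F (Set.uIcc (1 / 2 + (-ell D ^ 9 : ℝ)) (1 / 2 + (-1 : ℝ)) ×ℂ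
      Set.uIcc (2 * π * t0 D - ell1 D) (2 * π * t0 D + ell1 D)) := by
    intro s hs
    have h := Complex.mem_reProdIm.mp hs
    rw [Set.uIcc_of_le (by linarith), Set.uIcc_of_le (by linarith)] at h
    exact (hFat s (by linarith [h.1.2])).differentiableWithinAt
  -- the pointwise bound
  set G : ℝ := S * Cb * (⌈bigP D / bigT D ^ 2⌉₊ : ℝ) * ((⌊bigP D ^ 2⌋₊ : ℝ) + 1) ^ 2 with hG
  have hG0 : 0 ≤ G := by rw [hG]; positivity
  have hGle : G ≤ S * Cb * (bigP D * (bigP D ^ 2 + 1) ^ 2) := by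
    rw [hG]
    have hN : (⌈bigP D / bigT D ^ 2⌉₊ : ℝ) ≤ bigP D := ceil_PT2_le_bigP (by linarith)
    have hY : ((⌊bigP D ^ 2⌋₊ : ℝ) + 1) ^ 2 ≤ (bigP D ^ 2 + 1) ^ 2 :=
      pow_le_pow_left₀ (by positivity) (by linarith [Nat.floor_le (show 0 ≤ bigP D ^ 2 by positivity)]) 2
    have h0 : 0 ≤ S * Cb := mul_nonneg hS0 hCb0
    calc S * Cb * (⌈bigP D / bigT D ^ 2⌉₊ : ℝ) * ((⌊bigP D ^ 2⌋₊ : ℝ) + 1) ^ 2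
        = S * Cb * ((⌈bigP D / bigT D ^ 2⌉₊ : ℝ) * ((⌊bigP D ^ 2⌋₊ : ℝ) + 1) ^ 2) := by ring
      _ ≤ S * Cb * (bigP D * (bigP D ^ 2 + 1) ^ 2) :=
          mul_le_mul_of_nonneg_left (mul_le_mul hN hY (by positivity) hP0.le) h0
  have hprod : ∀ s : ℂ, s.re ≤ -1 / 2 →
      ‖conj (x.ψ (D : ZMod x.p)) * (D : ℂ) ^ (-(1 - s)) * Lf (1 - s) * Bpoly χ x s‖ ≤
        G * b ^ (1 - s).re :=
    fun s hs => norm_Dpow_tail_Bpoly_le c' χ hℓ3 x hs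
  -- Step 1: the segment `𝔍(−𝓛⁹)`
  have hbpow : b ^ (ell D ^ 9 + 1 / 2) ≤ Real.exp (-ell D ^ 10) := base_pow_le hℓ1 hb0 hbT
  have hre : ∀ v : ℝ, (((-ell D ^ 9 : ℝ) : ℂ) + s0 D + v * I).re = -ell D ^ 9 + 1 / 2 := by
    intro v; simp [s0, SmoothWeight.s0, -Complex.ofReal_pow]
  have him : ∀ v : ℝ, (((-ell D ^ 9 : ℝ) : ℂ) + s0 D + v * I).im = 2 * π * t0 D + v := by
    intro v; simp [s0, SmoothWeight.s0, -Complex.ofReal_pow]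
  have hfar : ‖intJ D (-ell D ^ 9) F‖ ≤ G * Real.exp (-ell D ^ 10) * C' := by
    refine (norm_intJ_le_absIntJ D hL0 _ F).trans ?_
    have hpt := continuous_segPoint (D := D) (-ell D ^ 9)
    have hFc : ContinuousOn (fun v : ℝ => F (((-ell D ^ 9 : ℝ) : ℂ) + s0 D + v * I))
        (Set.uIcc (-ell1 D) (ell1 D)) := by
      intro v _
      have h1 : DifferentiableAt ℂ F (((-ell D ^ 9 : ℝ) : ℂ) + s0 D + v * I) :=
        hFat _ (by rw [hre]; linarith)
      exact (ContinuousAt.comp (f := fun v : ℝ => ((-ell D ^ 9 : ℝ) : ℂ) + s0 D + v * I)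
        h1.continuousAt hpt.continuousAt).continuousWithinAt
    have hωc : Continuous fun v : ℝ => ‖omegaW D (((-ell D ^ 9 : ℝ) : ℂ) + s0 D + v * I)‖ :=
      (continuous_omegaW_seg (D := D) (-ell D ^ 9)).norm
    have hptw : ∀ v ∈ Set.Icc (-ell1 D) (ell1 D),
        ‖F (((-ell D ^ 9 : ℝ) : ℂ) + s0 D + v * I)‖ ≤
          G * Real.exp (-ell D ^ 10) * ‖omegaW D (((-ell D ^ 9 : ℝ) : ℂ) + s0 D + v * I)‖ := by
      intro v _
      have h := hprod (((-ell D ^ 9 : ℝ) : ℂ) + s0 D + v * I) (by rw [hre]; linarith)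
      have hure : (1 - (((-ell D ^ 9 : ℝ) : ℂ) + s0 D + v * I)).re = ell D ^ 9 + 1 / 2 := by
        rw [sub_re, one_re, hre]; ring
      rw [hure] at h
      show ‖conj (x.ψ (D : ZMod x.p)) * (D : ℂ) ^ (-(1 - _)) * Lf (1 - _) * Bpoly χ x _ * omegaW D _‖ ≤ _
      rw [norm_mul]
      exact mul_le_mul_of_nonneg_right (h.trans (mul_le_mul_of_nonneg_left hbpow hG0)) (norm_nonneg _)
    have hGe : 0 ≤ G * Real.exp (-ell D ^ 10) := mul_nonneg hG0 (Real.exp_pos _).le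
    calc absIntJ D (-ell D ^ 9) F
        = ∫ v in (-ell1 D)..ell1 D, ‖F (((-ell D ^ 9 : ℝ) : ℂ) + s0 D + v * I)‖ := rfl
      _ ≤ ∫ v in (-ell1 D)..ell1 D,
            G * Real.exp (-ell D ^ 10) * ‖omegaW D (((-ell D ^ 9 : ℝ) : ℂ) + s0 D + v * I)‖ :=
          intervalIntegral.integral_mono_on (by linarith) (hFc.norm.intervalIntegrable)
            ((continuous_const.mul hωc).intervalIntegrable _ _) hptw
      _ = G * Real.exp (-ell D ^ 10) * absIntJ D (-ell D ^ 9) (omegaW D) := by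
          rw [intervalIntegral.integral_const_mul]; rfl
      _ ≤ G * Real.exp (-ell D ^ 10) * C' :=
          mul_le_mul_of_nonneg_left ((H74 D χ hD1 hq hp (-ell D ^ 9) (by
            rw [abs_neg, abs_of_nonneg (le_trans zero_le_one hℓ9)])).trans (le_max_left _ _)) hGe
  -- Step 2: the horizontal sides
  set Mh : ℝ := G * (2 * Real.exp (1 / 4) * Real.exp (-(ell D ^ 10 / 4))) with hMh
  have hM : ∀ u ∈ Set.Icc (1 / 2 + (-ell D ^ 9 : ℝ)) (1 / 2 + (-1 : ℝ)), ∀ v : ℝ, v ^ 2 = ell1 D ^ 2 →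
      ‖F ((u : ℂ) + ((2 * π * t0 D + v : ℝ) : ℂ) * I)‖ ≤ Mh := by
    intro u hu v hv
    have hu0 : 1 / 2 - ell D ^ 9 ≤ u := by linarith [hu.1]
    have hu1 : u ≤ -1 / 2 := by linarith [hu.2]
    have hsre : ((u : ℂ) + ((2 * π * t0 D + v : ℝ) : ℂ) * I).re = u := by simp
    have h := hprod ((u : ℂ) + ((2 * π * t0 D + v : ℝ) : ℂ) * I) (by rw [hsre]; exact hu1)
    have hure : (1 - ((u : ℂ) + ((2 * π * t0 D + v : ℝ) : ℂ) * I)).re = 1 - u := by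
      rw [sub_re, one_re, hsre]
    rw [hure] at h
    have hbu : b ^ (1 - u) ≤ 1 := Real.rpow_le_one hb0 hb1 (by linarith)
    have hω : ‖omegaW D ((u : ℂ) + ((2 * π * t0 D + v : ℝ) : ℂ) * I)‖ ≤
        2 * Real.exp (1 / 4) * Real.exp (-(ell D ^ 10 / 4)) :=
      norm_omegaW_side_le_left hD3 hu0 (by linarith) hv
    show ‖conj (x.ψ (D : ZMod x.p)) * (D : ℂ) ^ (-(1 - _)) * Lf (1 - _) * Bpoly χ x _ * omegaW D _‖ ≤ Mh
    rw [norm_mul, hMh]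
    refine mul_le_mul (h.trans ?_) hω (norm_nonneg _) hG0
    calc G * b ^ (1 - u) ≤ G * 1 := mul_le_mul_of_nonneg_left hbu hG0
      _ = G := mul_one _
  have hshift : ‖intJ D (-1) F - intJ D (-ell D ^ 9) F‖ ≤ ((-1 : ℝ) - (-ell D ^ 9)) * (Mh + Mh) := by
    refine norm_intJ_sub_intJ_le D (by linarith) hdiff (fun u hu => hM u hu _ rfl) fun u hu => ?_
    have e : (2 * π * t0 D - ell1 D : ℝ) = 2 * π * t0 D + -ell1 D := by ring
    rw [e]
    exact hM u hu _ (by ring)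
  -- Step 3: assemble with the budgets
  have hK : 0 ≤ S * Cb := mul_nonneg hS0 hCb0
  have hbud1 := budget_far hℓ40
  have hbud2 := budget_sides hℓ40
  have hE1 : 0 ≤ Real.exp (-ell D ^ 10) := (Real.exp_pos _).le
  have hE4 : 0 ≤ Real.exp (-(ell D ^ 10 / 4)) := (Real.exp_pos _).le
  calc ‖intJ D (-1) F‖ = ‖intJ D (-ell D ^ 9) F + (intJ D (-1) F - intJ D (-ell D ^ 9) F)‖ := by
        rw [add_sub_cancel]
    _ ≤ ‖intJ D (-ell D ^ 9) F‖ + ‖intJ D (-1) F - intJ D (-ell D ^ 9) F‖ := norm_add_le _ _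
    _ ≤ G * Real.exp (-ell D ^ 10) * C' + ((-1 : ℝ) - (-ell D ^ 9)) * (Mh + Mh) := add_le_add hfar hshift
    _ = C' * (G * Real.exp (-ell D ^ 10)) +
          4 * Real.exp (1 / 4) * ((ell D ^ 9 - 1) * (G * Real.exp (-(ell D ^ 10 / 4)))) := by
        rw [hMh]; ring
    _ ≤ C' * (S * Cb * (bigP D * (bigP D ^ 2 + 1) ^ 2) * Real.exp (-ell D ^ 10)) +
          4 * Real.exp (1 / 4) * ((ell D ^ 9 - 1) *
            (S * Cb * (bigP D * (bigP D ^ 2 + 1) ^ 2) * Real.exp (-(ell D ^ 10 / 4)))) := by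
        have h9' : 0 ≤ ell D ^ 9 - 1 := by linarith
        gcongr
    _ = S * Cb * C' * (bigP D * (bigP D ^ 2 + 1) ^ 2 * Real.exp (-ell D ^ 10)) +
          S * Cb * (4 * Real.exp (1 / 4)) *
            ((ell D ^ 9 - 1) * (bigP D * (bigP D ^ 2 + 1) ^ 2 * Real.exp (-(ell D ^ 10 / 4)))) := by
        ring
    _ ≤ S * Cb * C' * Real.exp (-(1 / 16) * ell D ^ 10) +
          S * Cb * (4 * Real.exp (1 / 4)) * Real.exp (-(1 / 16) * ell D ^ 10) :=
        add_le_add (mul_le_mul_of_nonneg_left hbud1 (mul_nonneg hK (le_max_right _ _)))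
          (mul_le_mul_of_nonneg_left hbud2 (mul_nonneg hK (by positivity)))
    _ = S * Cb * (C' + 4 * Real.exp (1 / 4)) * Real.exp (-(1 / 16) * ell D ^ 10) := by ring

end Literature.NumberTheory.LFunctions.Zhang2022.Typed.Section15A.U009
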